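import Summits.CriticalPhenomena.PercolationContinuityZ3.Theorems.PercNearOneGluingNoHeavyLowerTailKNGoodTilt
import Literature.Probability.Percolation.KozmaNitzanGoodQuadruple
import HarnessLib

/-!
# `NoHeavyLowerTail` (stmt-CriticalPhenomena-4575) — EVERY quadruple with two relays is good, WITHOUT separation
# (Kozma–Nitzan goodness for `|A| = 2` on an arbitrary finite weighted graph)

Support file (`--supports stmt-CriticalPhenomena-4575`, hull-port prover `prim-hp-2`, gen 23).  No definitions, no named
facts, no sorries; standard axioms.

Kozma–Nitzan (arXiv:2401.12397, §3.2 p. 12) call a quadruple `(G, A, 0, b)` GOOD if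
`P(0 ↔ b) ≥ min_a P(a ↔ b) − Σ_{W ∩ A = ∅} P(C(0) = W) · min_a P_{G∖W}(a ↔ b)`; a good quadruple satisfies their
pre-FKG inequality (2).  The tree's `KNGoodTwoRelays.knGood_two_relays` (gen 10) proves goodness for `A = {a₁, a₂}` when
`A` SEPARATES `0` from `b`; `KNGoodB3.knGood_threeRelays` (gen 21) does `|A| = 3`, separated.  THIS FILE removes the
separation hypothesis at `|A| = 2`:

* `KNGoodTilt.tilt` (file `…KNGoodTilt.lean`) — **the tilting lemma.**  For vertices `o, a, b, c` and ANY family `𝒬` of vertex sets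
  missing `a` and `c`, with `F = {o ↔ a} ∪ {C(o) ∈ 𝒬}`:  if `μ(c↔b, a↮b) ≤ μ(a↔b, c↮b)` (i.e. `P(c↔b) ≤ P(a↔b)`) then
  `μ({c↔b, a↮b} ∩ F) ≤ μ({a↔b, c↮b} ∩ F)` — the event `F` tilts the competition between the relays `c` and `a` for
  `b` towards `a`.  Proof: two instances of the pocket-augmented BHK inequality `KNGoodPocketBHK.real_pocketAugSet_openConn_ge`
  (sources `{a,b}` resp. `{c,b}`, sinks `{c}` resp. `{a}`, the second with the complementary family) routed through the world
  where `a, b, c` are pairwise separated; the degenerate case `μ(a,b,c separated) = 0` by Harris' inequality.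
* `KNGoodTwoRelaysGeneral.knGood_pair_of_le`, **`KNGoodTwoRelaysGeneral.knGood_pair`** — for ANY finite weighted graph,
  ANY observer `o`, target `b` and relays `a₁ ≠ a₂`: `KNGood w {a₁, a₂} _ o b`.  (Pocket by pocket,
  `P(C(o)=W)·min_a P_{G∖W}(a↔b) = min_a μ(C(o)=W, a↔b) = μ(C(o)=W, c↔b) − (μ(C(o)=W, c↔b) − μ(C(o)=W, a↔b))⁺` by the spatial
  Markov property; the positive parts are summed over the family `𝒬` where they are positive and paid for by `tilt`.)

The reduction behind it (prim-hp-2 gen 23): goodness of `(G, A, o, b)` is goodness of `(G, A ∪ {b}, o, b)`, so goodness of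
ALL quadruples with `k − 1` relays is the slice "T-side = one edge" of universal goodness for separated quadruples with
`k` relays; `k = 3` here.
[cite: KozmaNitzan2024, §3.2 Definition (p. 12), Thm. 1 (p. 7), Thms. 4–5 (pp. 12–14)]
[cite: VandenbergHaggstromKahn2005, Thm. 1.1 (pp. 3–5), Remark 1 (p. 5)]
-/

noncomputable section

namespace Summit.CriticalPhenomena.PercolationContinuityZ3.Theorems

open MeasureTheory Set Literature.Probability.LatticeModels Literature.Probability.Percolation
open scoped Classical

namespace KNGoodTwoRelaysGeneral

open KNGoodAux KNGoodPocketBHK KNGoodTilt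

variable {V : Type*} [Fintype V]

/-! ### Goodness for two relays, no separation -/

/-- **Every quadruple with two relays is good — designated form** (`c, a` the relays, `P(c ↔ b) ≤ P(a ↔ b)`; any finite
weighted graph, any observer `o`, no separation hypothesis). [cite: KozmaNitzan2024, §3.2 Definition (p. 12), Thm. 1 (p. 7)] -/
theorem knGood_pair_of_le (w : Sym2 V → unitInterval) (o b c a : V) (hca : c ≠ a)
    (hle : (prodBernoulli w).real (openConn c b) ≤ (prodBernoulli w).real (openConn a b)) :
    KNGood w ({c, a} : Finset V) (Finset.insert_nonempty c {a}) o b := by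
  classical
  set μ := prodBernoulli w with hμ
  haveI : IsProbabilityMeasure μ := by rw [hμ]; infer_instance
  have hmeas : ∀ S : Set (BondConfig V), MeasurableSet S := fun _ => MeasurableSet.of_discrete
  have hAne : ({c, a} : Finset V).Nonempty := Finset.insert_nonempty c {a}
  -- pockets: `W ∩ A = ∅`
  have hnull : ∀ W ∈ nullSets ({c, a} : Finset V), c ∉ W ∧ a ∉ W := by
    intro W hW
    have hd := mem_nullSets.1 hW
    exact ⟨fun h => Finset.disjoint_left.1 hd h (by simp), fun h => Finset.disjoint_left.1 hd h (by simp)⟩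
  -- notation for the pocket cells
  set Pc : Finset V → ℝ := fun W => μ.real (clusterIs o W ∩ openConn c b) with hPc
  set Pa : Finset V → ℝ := fun W => μ.real (clusterIs o W ∩ openConn a b) with hPa
  -- Step A: the infimum is at most the designated relay's reliability
  have stepA : ({c, a} : Finset V).inf' hAne (fun x => μ.real (openConn x b)) ≤ μ.real (openConn c b) :=
    Finset.inf'_le _ (by simp)
  -- Step B: pocket by pocket, `P(C(o)=W) · min_x P_{G∖W}(x b) ≥ Pc W − (Pc W − Pa W)⁺`
  have stepB : ∀ W ∈ nullSets ({c, a} : Finset V),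
      Pc W - max (Pc W - Pa W) 0 ≤ μ.real (clusterIs o W) * ({c, a} : Finset V).inf' hAne (fun x => μ.real (openConnIn ((↑W : Set V)ᶜ) x b)) := by
    intro W hW
    obtain ⟨hcW, haW⟩ := hnull W hW
    have ec : Pc W = μ.real (clusterIs o W) * μ.real (openConnIn ((↑W : Set V)ᶜ) c b) :=
      real_clusterIs_inter_openConn w o W hcW b
    have ea : Pa W = μ.real (clusterIs o W) * μ.real (openConnIn ((↑W : Set V)ᶜ) a b) :=
      real_clusterIs_inter_openConn w o W haW b
    have hinf : ({c, a} : Finset V).inf' hAne (fun x => μ.real (openConnIn ((↑W : Set V)ᶜ) x b)) =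
        μ.real (openConnIn ((↑W : Set V)ᶜ) c b) ⊓ μ.real (openConnIn ((↑W : Set V)ᶜ) a b) := by
      rw [Finset.inf'_insert, Finset.inf'_singleton]
      exact Finset.singleton_nonempty a
    rw [hinf]
    have h0 : 0 ≤ μ.real (clusterIs o W) := measureReal_nonneg
    rcases le_total (μ.real (openConnIn ((↑W : Set V)ᶜ) c b)) (μ.real (openConnIn ((↑W : Set V)ᶜ) a b)) with h | h
    · rw [inf_eq_left.2 h, ← ec]
      linarith [le_max_right (Pc W - Pa W) 0]
    · rw [inf_eq_right.2 h, ← ea]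
      linarith [le_max_left (Pc W - Pa W) 0]
  have stepB' : ∑ W ∈ nullSets ({c, a} : Finset V), Pc W - ∑ W ∈ nullSets ({c, a} : Finset V), max (Pc W - Pa W) 0 ≤
      ∑ W ∈ nullSets ({c, a} : Finset V), μ.real (clusterIs o W) * ({c, a} : Finset V).inf' hAne (fun x => μ.real (openConnIn ((↑W : Set V)ᶜ) x b)) := by
    rw [← Finset.sum_sub_distrib]
    exact Finset.sum_le_sum stepB
  -- the designated part `Σ_W Pc W = μ(0 ↮ A, c ↔ b)`
  set NA : Set (BondConfig V) := {ω | ∀ x ∈ ({c, a} : Finset V), ¬ (openGraph ω).Reachable o x} with hNA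
  have sumPc : ∑ W ∈ nullSets ({c, a} : Finset V), Pc W = μ.real (NA ∩ openConn c b) :=
    sum_real_clusterIs_inter w {c, a} o _
  -- Step C: the positive parts live on the family `Pk`
  set Pk : Finset (Finset V) := (nullSets ({c, a} : Finset V)).filter fun W => Pa W < Pc W with hPk
  have hPksub : Pk ⊆ nullSets ({c, a} : Finset V) := Finset.filter_subset _ _
  have stepC : ∑ W ∈ nullSets ({c, a} : Finset V), max (Pc W - Pa W) 0 = ∑ W ∈ Pk, Pc W - ∑ W ∈ Pk, Pa W := by
    rw [← Finset.sum_sub_distrib, ← Finset.sum_filter_add_sum_filter_not (nullSets ({c, a} : Finset V)) (fun W => Pa W < Pc W)]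
    have e1 : ∑ W ∈ (nullSets ({c, a} : Finset V)).filter (fun W => Pa W < Pc W), max (Pc W - Pa W) 0 =
        ∑ W ∈ (nullSets ({c, a} : Finset V)).filter (fun W => Pa W < Pc W), (Pc W - Pa W) :=
      Finset.sum_congr rfl fun W hW => max_eq_left (by linarith [(Finset.mem_filter.1 hW).2])
    have e2 : ∑ W ∈ (nullSets ({c, a} : Finset V)).filter (fun W => ¬ Pa W < Pc W), max (Pc W - Pa W) 0 = 0 :=
      Finset.sum_eq_zero fun W hW => max_eq_right (by linarith [not_lt.1 (Finset.mem_filter.1 hW).2])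
    rw [e1, e2, add_zero]
  -- the union of the pockets of `Pk`
  set Poc : Set (BondConfig V) := ⋃ W ∈ Pk, clusterIs o W with hPoc
  have sumP : ∀ E : Set (BondConfig V), ∑ W ∈ Pk, μ.real (clusterIs o W ∩ E) = μ.real (Poc ∩ E) := by
    intro E
    have hdisj : Set.PairwiseDisjoint (↑Pk : Set (Finset V)) fun W => clusterIs o W ∩ E := by
      intro W _ W' _ hne
      exact (pairwise_disjoint_clusterIs o hne).mono inter_subset_left inter_subset_left
    rw [← measureReal_biUnion_finset hdisj fun W _ => hmeas _, hPoc, Set.iUnion₂_inter]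
  have sumPcPk : ∑ W ∈ Pk, Pc W = μ.real (Poc ∩ openConn c b) := sumP _
  have sumPaPk : ∑ W ∈ Pk, Pa W = μ.real (Poc ∩ openConn a b) := sumP _
  -- the family as a set of vertex sets, and the tilting event
  set 𝒬 : Set (Set V) := {S | ∃ W ∈ Pk, (↑W : Set V) = S} with h𝒬
  have h𝒬ac : ∀ S ∈ 𝒬, a ∉ S ∧ c ∉ S := by
    rintro S ⟨W, hW, rfl⟩
    obtain ⟨hcW, haW⟩ := hnull W (hPksub hW)
    exact ⟨fun h => haW (Finset.mem_coe.1 h), fun h => hcW (Finset.mem_coe.1 h)⟩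
  have memPoc : ∀ ω, ω ∈ Poc ↔ openCluster ω o ∈ 𝒬 := by
    intro ω
    simp only [hPoc, h𝒬, Set.mem_iUnion, Set.mem_setOf_eq, mem_clusterIs, exists_prop]
    constructor
    · rintro ⟨W, hW, h⟩; exact ⟨W, hW, h.symm⟩
    · rintro ⟨W, hW, h⟩; exact ⟨W, hW, h.symm⟩
  set F : Set (BondConfig V) := pocketAugSet {a} o 𝒬 with hF
  have hFeq : F = openConn o a ∪ Poc := by
    ext ω
    simp only [hF, pocketAugSet, openConn, memPoc, Set.mem_union, Set.mem_setOf_eq, Set.mem_singleton_iff,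
      exists_eq_left]
  have hdisjF : Disjoint (openConn o a) Poc := by
    rw [Set.disjoint_left]
    intro ω hoa hP
    rw [memPoc] at hP
    obtain ⟨haC, -⟩ := h𝒬ac _ hP
    exact haC hoa
  have splitF : ∀ E : Set (BondConfig V), μ.real (E ∩ F) = μ.real (E ∩ openConn o a) + μ.real (E ∩ Poc) := by
    intro E
    rw [hFeq, Set.inter_union_distrib_left,
      measureReal_union (hdisjF.mono inter_subset_right inter_subset_right) (hmeas _)]
  -- the tilting events
  set Ec : Set (BondConfig V) := {ω | (openGraph ω).Reachable c b ∧ ¬ (openGraph ω).Reachable a b} with hEc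
  set Ea : Set (BondConfig V) := {ω | (openGraph ω).Reachable a b ∧ ¬ (openGraph ω).Reachable c b} with hEa
  have hleE : μ.real Ec ≤ μ.real Ea := by
    have e1 : μ.real (openConn c b ∩ openConn a b) + μ.real (openConn c b \ openConn a b) = μ.real (openConn c b) :=
      measureReal_inter_add_sdiff (hmeas _)
    have e2 : μ.real (openConn a b ∩ openConn c b) + μ.real (openConn a b \ openConn c b) = μ.real (openConn a b) :=
      measureReal_inter_add_sdiff (hmeas _)
    have e3 : (openConn c b : Set (BondConfig V)) \ openConn a b = Ec := by
      ext ω; simp only [openConn, hEc, Set.mem_sdiff, Set.mem_setOf_eq]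
    have e4 : (openConn a b : Set (BondConfig V)) \ openConn c b = Ea := by
      ext ω; simp only [openConn, hEa, Set.mem_sdiff, Set.mem_setOf_eq]
    rw [Set.inter_comm] at e2
    rw [e3] at e1; rw [e4] at e2
    linarith
  have htilt : μ.real (Ec ∩ F) ≤ μ.real (Ea ∩ F) := tilt w o a b c 𝒬 h𝒬ac hleE
  -- Step D: the designated part
  have d0 : μ.real (openConn c b ∩ NA) + μ.real (openConn c b \ NA) = μ.real (openConn c b) :=
    measureReal_inter_add_sdiff (hmeas _)
  set G₁ : Set (BondConfig V) := {ω | (openGraph ω).Reachable o b ∧ (openGraph ω).Reachable o c} with hG₁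
  have d1 : μ.real (openConn c b \ NA) ≤ μ.real G₁ + μ.real (Ec ∩ openConn o a) := by
    refine (measureReal_mono (fun ω hω => ?_)).trans (measureReal_union_le G₁ (Ec ∩ openConn o a))
    obtain ⟨hcb, hNAω⟩ := hω
    simp only [hNA, Set.mem_setOf_eq, not_forall, not_not, exists_prop] at hNAω
    obtain ⟨x, hxA, hox⟩ := hNAω
    simp only [Finset.mem_insert, Finset.mem_singleton] at hxA
    simp only [hG₁, hEc, openConn, Set.mem_union, Set.mem_inter_iff, Set.mem_setOf_eq]
    simp only [openConn, Set.mem_setOf_eq] at hcb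
    by_cases hoc : (openGraph ω).Reachable o c
    · exact Or.inl ⟨hoc.trans hcb, hoc⟩
    · rcases hxA with rfl | rfl
      · exact absurd hox hoc
      · exact Or.inr ⟨⟨hcb, fun hab => hoc ((hox.trans hab).trans hcb.symm)⟩, hox⟩
  have d2 : μ.real G₁ + μ.real (Ea ∩ openConn o a) ≤ μ.real (openConn o b) := by
    have hd : Disjoint G₁ (Ea ∩ openConn o a) := by
      rw [Set.disjoint_left]
      rintro ω ⟨hob, hoc⟩ ⟨⟨hab, hcb⟩, hoa⟩
      exact hcb (hoc.symm.trans hob)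
    rw [← measureReal_union hd (hmeas _)]
    refine measureReal_mono (fun ω hω => ?_)
    simp only [openConn, Set.mem_setOf_eq]
    rcases hω with ⟨hob, -⟩ | ⟨⟨hab, -⟩, hoa⟩
    · exact hob
    · exact hoa.trans hab
  have d3 : μ.real (Poc ∩ openConn c b) - μ.real (Poc ∩ openConn a b) = μ.real (Ec ∩ Poc) - μ.real (Ea ∩ Poc) := by
    have e1 : μ.real ((Poc ∩ openConn c b) ∩ openConn a b) + μ.real ((Poc ∩ openConn c b) \ openConn a b) =
        μ.real (Poc ∩ openConn c b) := measureReal_inter_add_sdiff (hmeas _)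
    have e2 : μ.real ((Poc ∩ openConn a b) ∩ openConn c b) + μ.real ((Poc ∩ openConn a b) \ openConn c b) =
        μ.real (Poc ∩ openConn a b) := measureReal_inter_add_sdiff (hmeas _)
    have e3 : (Poc ∩ openConn c b) ∩ openConn a b = (Poc ∩ openConn a b) ∩ openConn c b := by
      rw [Set.inter_assoc, Set.inter_assoc, Set.inter_comm (openConn c b)]
    have e4 : (Poc ∩ openConn c b) \ openConn a b = Ec ∩ Poc := by
      ext ω; simp only [openConn, hEc, Set.mem_sdiff, Set.mem_inter_iff, Set.mem_setOf_eq]; tauto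
    have e5 : (Poc ∩ openConn a b) \ openConn c b = Ea ∩ Poc := by
      ext ω; simp only [openConn, hEa, Set.mem_sdiff, Set.mem_inter_iff, Set.mem_setOf_eq]; tauto
    rw [e3] at e1; rw [e4] at e1; rw [e5] at e2
    linarith
  have sEc := splitF Ec
  have sEa := splitF Ea
  -- assemble
  rw [KNGood]
  rw [Set.inter_comm] at sumPc
  have hsum := stepB'
  rw [stepC, sumPc, sumPcPk, sumPaPk] at hsum
  linarith

/-- **EVERY QUADRUPLE WITH TWO RELAYS IS GOOD** (Kozma–Nitzan §3.2), for an ARBITRARY finite weighted graph, observer `o`,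
target `b` and relays `a₁ ≠ a₂` — no separation hypothesis:
`P(o ↔ b) ≥ min_a P(a ↔ b) − Σ_{W ∩ A = ∅} P(C(o) = W) · min_a P_{G∖W}(a ↔ b)`.
[cite: KozmaNitzan2024, §3.2 Definition (p. 12), Thm. 1 (p. 7), Thms. 4–5 (pp. 12–14)] -/
theorem knGood_pair (w : Sym2 V → unitInterval) (o b a₁ a₂ : V) (h12 : a₁ ≠ a₂) :
    KNGood w ({a₁, a₂} : Finset V) (Finset.insert_nonempty a₁ {a₂}) o b := by
  rcases le_total ((prodBernoulli w).real (openConn a₁ b)) ((prodBernoulli w).real (openConn a₂ b)) with h | h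
  · exact knGood_pair_of_le w o b a₁ a₂ h12 h
  · have hpair : ({a₁, a₂} : Finset V) = {a₂, a₁} := Finset.pair_comm a₁ a₂
    have key := knGood_pair_of_le w o b a₂ a₁ h12.symm h
    simp only [← hpair] at key
    exact key

end KNGoodTwoRelaysGeneral

end Summit.CriticalPhenomena.PercolationContinuityZ3.Theorems
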